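import Summits.Ventures.DiscreteObjects.PP12.OrderElevenTriangleKernel
import Summits.Ventures.DiscreteObjects.PP12.OrderElevenTriangleRowCode

/-!
# PP(12), order-11 cell, Case B (`NoTriangleData12`): SOUNDNESS of the label walker (designs g23)
Framing: lottery ticket; floor = certified bounds/negative ranges.

Cell pub-namedobj (venture DiscreteObjects), target (M). `lab P blocks …` (`OrderElevenTriangleKernel`) labels a list of blocks by distinct `t` subject to the
translate conditions (K1)/(K2) and emits packed rows. Here: if the block list consists of the (codes of the) non-empty blocks `E_{s,t}` of a free line orbit `s`
of data `D` satisfying (K0), (K1), (K2) — each exactly once, in any order — then the packed row `rowCode D s` (`OrderElevenTriangleRowCode`) is among the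
emitted rows: **`rowCode_mem_lab`**, and hence **`rowCode_mem_rowsFrom_of`** for any partition list containing such a block list (the partition walker's
side is `OrderElevenTriangleWalkSound`). Semantic invariant `LInv` (covered labels ↔ the three masks and the partial block word), `rot` bit semantics,
`fz` on a one-hole mask. Proofs only; nothing here asserts a census statement. No `sorry`, no new axioms.
-/

namespace Summit.Ventures.DiscreteObjects.PP12

namespace Triangle12

open Function
open Fin.CommRing -- `Fin 11` as a commutative ring (scoped Mathlib instance): cyclic residue arithmetic

variable (D : TriangleData 11) (s : Fin 11)

/-! ### bit semantics of `rot` and `fz` -/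

/-- bit `i` of the translate `rot B v` (`B < 2^11`, `v ≤ 10`) is bit `(i + v) mod 11` of `B`, for `i < 11` -/
theorem testBit_rot {B v : ℕ} (hB : B < 2 ^ 11) (hv : v < 11) (i : ℕ) :
    (rot B v).testBit i = (decide (i < 11) && B.testBit ((i + v) % 11)) := by
  have h2047 : (2047 : ℕ) = 2 ^ 11 - 1 := by norm_num
  simp only [rot, h2047, Nat.testBit_and, Nat.testBit_or, Nat.testBit_shiftRight, Nat.testBit_shiftLeft,
    Nat.testBit_two_pow_sub_one]
  by_cases hi : i < 11
  · simp only [hi, decide_true, Bool.and_true, Bool.true_and]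
    by_cases hiv : i + v < 11
    · have e1 : (i + v) % 11 = v + i := by omega
      have e2 : ¬ (i ≥ 11 - v) := by omega
      simp [e1, e2]
    · have e1 : (i + v) % 11 = i - (11 - v) := by omega
      have e2 : i ≥ 11 - v := by omega
      have e3 : B.testBit (v + i) = false := Nat.testBit_lt_two_pow (lt_of_lt_of_le hB (Nat.pow_le_pow_right (by norm_num) (by omega)))
      simp [e1, e2, e3]
  · simp [hi]

/-- bit `i` of `rot (maskE D s t) v` is `memN D s t ((i + v) mod 11)` for `i < 11` -/
theorem testBit_rot_maskE {t v : ℕ} (hv : v < 11) (i : ℕ) :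
    (rot (maskE D s t) v).testBit i = (decide (i < 11) && memN D s t ((i + v) % 11)) := by
  rw [testBit_rot (maskE_lt D s t) hv, testBit_maskE]

/-- `fz` on a mask with exactly one zero bit `g` among `0 … 10` returns `g` -/
theorem fz_eq {u g : ℕ} (hg : g < 11) (hu : ∀ i, i < 11 → (u.testBit i = false ↔ i = g)) :
    ∀ c, c ≤ 11 → 11 - c ≤ g → fz u c = g
  | 0, _, h => by omega
  | c + 1, hc, h => by
    rw [fz]
    by_cases hi : 10 - c = g
    · have : u.testBit (10 - c) = false := (hu _ (by omega)).2 hi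
      rw [if_neg (by rw [this]; exact Bool.false_ne_true)]; exact hi
    · have : u.testBit (10 - c) = true := by
        by_contra hf
        exact hi ((hu _ (by omega)).1 (by simpa using hf))
      rw [if_pos this]
      exact fz_eq hg hu c (by omega) (by omega)

/-! ### the semantic invariant of the label walker -/

/-- the state `(usedT, used1, used2, A)` describes the set `C` of already labelled blocks -/
structure LInv (φ : Fin 11 → Fin 11) (C : Finset (Fin 11)) (usedT used1 used2 A : ℕ) : Prop where
  /-- `usedT` = the labels in `C` -/
  hT : ∀ i, usedT.testBit i = true ↔ ∃ t ∈ C, t.val = i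
  /-- `used1` = the translates `E_t − t`, `t ∈ C` -/
  h1 : ∀ i, used1.testBit i = true ↔ i < 11 ∧ ∃ t ∈ C, memN D s t.val ((i + t.val) % 11) = true
  /-- `used2` = the translates `E_t − φ t`, `t ∈ C` -/
  h2 : ∀ i, used2.testBit i = true ↔ i < 11 ∧ ∃ t ∈ C, memN D s t.val ((i + (φ t).val) % 11) = true
  /-- `A` = the blocks `E_t`, `t ∈ C`, in their slots -/
  hA : ∀ p, A.testBit p = true ↔ p % 22 < 11 ∧ ∃ t ∈ C, t.val = p / 22 ∧ memN D s t.val (p % 22) = true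

/-- the empty state -/
theorem linv_empty (φ : Fin 11 → Fin 11) : LInv D s φ ∅ 0 0 0 0 :=
  ⟨fun i => by simp, fun i => by simp, fun i => by simp, fun p => by simp⟩

variable {D s}

/-- one labelling step: adding block `t ∉ C` with its true label updates the state consistently -/
theorem linv_step {φ : Fin 11 → Fin 11} {C : Finset (Fin 11)} {usedT used1 used2 A : ℕ} (h : LInv D s φ C usedT used1 used2 A)
    (t : Fin 11) :
    LInv D s φ (insert t C) (usedT ||| (1 <<< t.val)) (used1 ||| rot (maskE D s t.val) t.val)
      (used2 ||| rot (maskE D s t.val) (φ t).val) (A ||| (maskE D s t.val <<< (22 * t.val))) := by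
  refine ⟨fun i => ?_, fun i => ?_, fun i => ?_, fun p => ?_⟩
  · rw [Nat.testBit_or, Bool.or_eq_true, h.hT, Nat.testBit_shiftLeft]
    simp only [Finset.mem_insert, Bool.and_eq_true, decide_eq_true_eq, Nat.testBit_one_eq_true_iff_self_eq_zero]
    constructor
    · rintro (⟨u, hu, e⟩ | ⟨h1, h2⟩)
      · exact ⟨u, Or.inr hu, e⟩
      · exact ⟨t, Or.inl rfl, by omega⟩
    · rintro ⟨u, (rfl | hu), e⟩
      · right; omega
      · exact Or.inl ⟨u, hu, e⟩
  · rw [Nat.testBit_or, Bool.or_eq_true, h.h1, testBit_rot_maskE D s t.isLt]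
    simp only [Finset.mem_insert, Bool.and_eq_true, decide_eq_true_eq]
    constructor
    · rintro (⟨hi, u, hu, e⟩ | ⟨hi, e⟩)
      · exact ⟨hi, u, Or.inr hu, e⟩
      · exact ⟨hi, t, Or.inl rfl, e⟩
    · rintro ⟨hi, u, (rfl | hu), e⟩
      · exact Or.inr ⟨hi, e⟩
      · exact Or.inl ⟨hi, u, hu, e⟩
  · rw [Nat.testBit_or, Bool.or_eq_true, h.h2, testBit_rot_maskE D s (φ t).isLt]
    simp only [Finset.mem_insert, Bool.and_eq_true, decide_eq_true_eq]
    constructor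
    · rintro (⟨hi, u, hu, e⟩ | ⟨hi, e⟩)
      · exact ⟨hi, u, Or.inr hu, e⟩
      · exact ⟨hi, t, Or.inl rfl, e⟩
    · rintro ⟨hi, u, (rfl | hu), e⟩
      · exact Or.inr ⟨hi, e⟩
      · exact Or.inl ⟨hi, u, hu, e⟩
  · rw [Nat.testBit_or, Bool.or_eq_true, h.hA, Nat.testBit_shiftLeft, Bool.and_eq_true, decide_eq_true_eq, testBit_maskE]
    simp only [Finset.mem_insert]
    constructor
    · rintro (⟨hp, u, hu, e1, e2⟩ | ⟨hge, e⟩)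
      · exact ⟨hp, u, Or.inr hu, e1, e2⟩
      · have hlt : p - 22 * t.val < 11 := by
          by_contra hn; rw [memN_of_ge D s (not_lt.1 hn)] at e; exact Bool.false_ne_true e
        have e1 : t.val = p / 22 := by omega
        have e2 : p % 22 = p - 22 * t.val := by omega
        exact ⟨by omega, t, Or.inl rfl, e1, by rw [e2]; exact e⟩
    · rintro ⟨hp, u, (rfl | hu), e1, e2⟩
      · right
        have e3 : p - 22 * u.val = p % 22 := by omega
        exact ⟨by omega, by rw [e3]; exact e2⟩
      · exact Or.inl ⟨hp, u, hu, e1, e2⟩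

/-! ### the true label passes the filters -/

section Filters

variable {φ : Fin 11 → Fin 11} {C : Finset (Fin 11)} {usedT used1 used2 A : ℕ}
  (hK1 : D.PartitionOK s id (D.g1 s)) (hK2 : D.PartitionOK s φ (D.g2 s)) (h : LInv D s φ C usedT used1 used2 A)
  {t : Fin 11} (ht : t ∉ C)
include h ht

/-- the true label is unused -/
theorem filterT : usedT.testBit t.val = false := by
  by_contra hc
  obtain ⟨u, hu, e⟩ := (h.hT _).1 (by simpa using hc)
  exact ht (Fin.ext e ▸ hu)

include hK1 in
/-- (K1): the translate `E_t − t` is disjoint from the earlier translates -/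
theorem filter1 : (rot (maskE D s t.val) t.val &&& used1) = 0 := by
  apply Nat.zero_of_testBit_eq_false
  intro i
  rw [Nat.testBit_and, Bool.and_eq_false_iff]
  by_contra hc
  simp only [not_or, Bool.not_eq_false] at hc
  obtain ⟨h1, h2⟩ := hc
  rw [testBit_rot_maskE D s t.isLt, Bool.and_eq_true, decide_eq_true_eq] at h1
  obtain ⟨hi, hm⟩ := h1
  obtain ⟨-, u, hu, hm'⟩ := (h.h1 i).1 h2
  -- both `t` and `u` carry the free point at position `i + label`: (K1) forces `t = u`
  obtain ⟨hA, hB⟩ := hK1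
  let y : Fin 11 := ⟨i, hi⟩
  have hyt : D.mem s t (y + id t) = true := by
    rw [← memN_val]; convert hm using 2; simp [y, Fin.val_add]
  have hyu : D.mem s u (y + id u) = true := by
    rw [← memN_val]; convert hm' using 2; simp [y, Fin.val_add]
  by_cases hy : y = D.g1 s
  · rw [hy] at hyt; rw [hA t] at hyt; exact Bool.false_ne_true hyt
  · obtain ⟨w, -, hw⟩ := hB y hy
    exact ht ((hw t hyt).trans (hw u hyu).symm ▸ hu)

include hK2 in
/-- (K2): the translate `E_t − φ t` is disjoint from the earlier translates -/
theorem filter2 : (rot (maskE D s t.val) (φ t).val &&& used2) = 0 := by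
  apply Nat.zero_of_testBit_eq_false
  intro i
  rw [Nat.testBit_and, Bool.and_eq_false_iff]
  by_contra hc
  simp only [not_or, Bool.not_eq_false] at hc
  obtain ⟨h1, h2⟩ := hc
  rw [testBit_rot_maskE D s (φ t).isLt, Bool.and_eq_true, decide_eq_true_eq] at h1
  obtain ⟨hi, hm⟩ := h1
  obtain ⟨-, u, hu, hm'⟩ := (h.h2 i).1 h2
  obtain ⟨hA, hB⟩ := hK2
  let y : Fin 11 := ⟨i, hi⟩
  have hyt : D.mem s t (y + φ t) = true := by
    rw [← memN_val]; convert hm using 2; simp [y, Fin.val_add]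
  have hyu : D.mem s u (y + φ u) = true := by
    rw [← memN_val]; convert hm' using 2; simp [y, Fin.val_add]
  by_cases hy : y = D.g2 s
  · rw [hy] at hyt; rw [hA t] at hyt; exact Bool.false_ne_true hyt
  · obtain ⟨w, -, hw⟩ := hB y hy
    exact ht ((hw t hyt).trans (hw u hyu).symm ▸ hu)

end Filters

/-! ### membership in `labT` / `lab` -/

/-- the branch of label `t` (when its three filters pass) is contained in `labT … c` for `11 − c ≤ t ≤ 10` -/
theorem mem_labT {P B : ℕ} {K : ℕ → ℕ → ℕ → ℕ → List ℕ} {usedT used1 used2 A : ℕ} {t : ℕ} (ht : t < 11)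
    (f0 : usedT.testBit t = false) (f1 : (rot B t &&& used1) = 0) (f2 : (rot B (dig P t) &&& used2) = 0) {x : ℕ}
    (hx : x ∈ K (usedT ||| (1 <<< t)) (used1 ||| rot B t) (used2 ||| rot B (dig P t)) (A ||| (B <<< (22 * t)))) :
    ∀ c, c ≤ 11 → 11 - c ≤ t → x ∈ labT P B K usedT used1 used2 A c
  | 0, _, h => by omega
  | c + 1, hc, h => by
    rw [labT, List.mem_append]
    by_cases htc : 10 - c = t
    · left; rw [htc, f0, f1, f2]; simpa using hx
    · right; exact mem_labT ht f0 f1 f2 hx c (by omega) (by omega)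

variable (D s)

/-- (K0): a free point determines its block -/
theorem label_unique (hK0 : D.PartitionOK s (fun _ => 0) 0) {t t' : Fin 11} {e : ℕ} (h1 : memN D s t.val e = true)
    (h2 : memN D s t'.val e = true) : t = t' := by
  have he : e < 11 := by by_contra hn; rw [memN_of_ge D s (not_lt.1 hn)] at h1; exact Bool.false_ne_true h1
  obtain ⟨hA, hB⟩ := hK0
  let y : Fin 11 := ⟨e, he⟩
  have m1 : D.mem s t (y + 0) = true := by rw [add_zero, ← memN_val]; exact h1
  have m2 : D.mem s t' (y + 0) = true := by rw [add_zero, ← memN_val]; exact h2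
  by_cases hy : y = 0
  · have := hA t; rw [zero_add, ← hy, ← add_zero y] at this; rw [this] at m1; exact absurd m1 Bool.false_ne_true
  · obtain ⟨w, -, hw⟩ := hB y hy
    exact (hw t m1).trans (hw t' m2).symm

/-- a non-zero block mask has an element -/
theorem exists_mem_of_maskE_ne_zero {t : ℕ} (h : maskE D s t ≠ 0) : ∃ e, memN D s t e = true := by
  obtain ⟨i, hi⟩ := Nat.exists_testBit_of_ne_zero h
  exact ⟨i, by rwa [testBit_maskE] at hi⟩

/-- **the label walker lists the true row.** Hypotheses: (K0), (K1), (K2) for the orbit `s`; `P` packs `φ`; the state describes the labelled blocks `C`;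
`todo` holds the codes of non-empty blocks `E_t`, `t ∉ C`, with pairwise distinct masks; every non-empty block is in `C` or in `todo`. -/
theorem rowCode_mem_lab {φ : Fin 11 → Fin 11} {P : ℕ} (hP : ∀ t : Fin 11, dig P t.val = (φ t).val)
    (hK0 : D.PartitionOK s (fun _ => 0) 0) (hK1 : D.PartitionOK s id (D.g1 s)) (hK2 : D.PartitionOK s φ (D.g2 s)) :
    ∀ (todo : List ℕ) (C : Finset (Fin 11)) (usedT used1 used2 A : ℕ), LInv D s φ C usedT used1 used2 A →
      (∀ b ∈ todo, ∃ t : Fin 11, t ∉ C ∧ b &&& 2047 = maskE D s t.val ∧ maskE D s t.val ≠ 0) →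
      (todo.map (· &&& 2047)).Nodup →
      (∀ t : Fin 11, maskE D s t.val ≠ 0 → t ∈ C ∨ ∃ b ∈ todo, b &&& 2047 = maskE D s t.val) →
      rowCode D s ∈ lab P todo usedT used1 used2 A
  | [], C, usedT, used1, used2, A, h, _, _, hcov => by
    rw [lab, List.mem_singleton]
    -- every non-empty block is labelled, so the state IS the row
    have hall : ∀ t : Fin 11, ∀ e, memN D s t.val e = true → t ∈ C := fun t e he => by
      have hne : maskE D s t.val ≠ 0 := fun h0 => by
        have hb := testBit_maskE D s t.val e
        rw [h0, Nat.zero_testBit] at hb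
        exact Bool.false_ne_true (hb.trans he)
      rcases hcov t hne with hc | ⟨b, hb, _⟩
      · exact hc
      · simp at hb
    have hAe : A = aword D s := Nat.eq_of_testBit_eq fun p => Bool.eq_iff_iff.2 (by
      rw [h.hA, testBit_aword]
      simp only [Bool.and_eq_true, decide_eq_true_eq]
      constructor
      · rintro ⟨hp, t, -, e1, e2⟩
        exact ⟨⟨by rw [← e1]; exact t.isLt, hp⟩, by rw [← e1]; exact e2⟩
      · rintro ⟨⟨h1, h2⟩, h3⟩
        exact ⟨h2, ⟨p / 22, h1⟩, hall ⟨p / 22, h1⟩ _ h3, rfl, h3⟩)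
    have hole : ∀ (f : Fin 11 → Fin 11) (g : Fin 11) (used : ℕ), D.PartitionOK s f g →
        (∀ i, used.testBit i = true ↔ i < 11 ∧ ∃ t ∈ C, memN D s t.val ((i + (f t).val) % 11) = true) → fz used 11 = g.val := by
      intro f g used hK hused
      obtain ⟨hA, hB⟩ := hK
      refine fz_eq g.isLt (fun i hi => ?_) 11 le_rfl (by omega)
      have hmem : ∀ t : Fin 11, memN D s t.val ((i + (f t).val) % 11) = D.mem s t (⟨i, hi⟩ + f t) := fun t => by
        rw [← memN_val, Fin.val_add]
      constructor
      · intro hf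
        by_contra hig
        obtain ⟨t, ht, -⟩ := hB ⟨i, hi⟩ (fun e => hig (congrArg Fin.val e))
        have hm : memN D s t.val ((i + (f t).val) % 11) = true := by rw [hmem]; exact ht
        have : used.testBit i = true := (hused i).2 ⟨hi, t, hall t _ hm, hm⟩
        rw [hf] at this; exact Bool.false_ne_true this
      · intro hig
        by_contra hne
        rw [Bool.not_eq_false] at hne
        obtain ⟨-, t, -, hm⟩ := (hused i).1 hne
        rw [hmem, show (⟨i, hi⟩ : Fin 11) = g from Fin.ext hig, hA t] at hm
        exact Bool.false_ne_true hm
    have e1 := hole id (D.g1 s) used1 hK1 h.h1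
    have e2 := hole φ (D.g2 s) used2 hK2 h.h2
    rw [rowCode, ← hAe, e1, e2]
  | b :: rest, C, usedT, used1, used2, A, h, htodo, hnd, hcov => by
    obtain ⟨t, htC, hb, hne⟩ := htodo b (by simp)
    rw [lab]
    have hx := rowCode_mem_lab hP hK0 hK1 hK2 rest (insert t C) _ _ _ _ (linv_step h t) ?_ ?_ ?_
    · refine mem_labT t.isLt (filterT h htC) ?_ ?_ ?_ 11 le_rfl (by omega)
      · rw [hb]; exact filter1 hK1 h htC
      · rw [hb, hP]; exact filter2 hK2 h htC
      · rw [hb, hP]; exact hx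
    · intro b' hb'
      obtain ⟨t', ht'C, hb'e, hne'⟩ := htodo b' (List.mem_cons_of_mem _ hb')
      refine ⟨t', ?_, hb'e, hne'⟩
      rw [Finset.mem_insert, not_or]
      refine ⟨fun htt => ?_, ht'C⟩
      rw [List.map_cons, List.nodup_cons] at hnd
      exact hnd.1 (List.mem_map.2 ⟨b', hb', (by rw [hb'e, htt, ← hb] : b' &&& 2047 = b &&& 2047)⟩)
    · rw [List.map_cons, List.nodup_cons] at hnd; exact hnd.2
    · intro u hu
      rcases hcov u hu with hc | ⟨b'', hb'', he⟩
      · exact Or.inl (Finset.mem_insert_of_mem hc)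
      · rcases List.mem_cons.1 hb'' with rfl | hr
        · -- the same mask as `b`: the same label
          left
          have e : maskE D s u.val = maskE D s t.val := he.symm.trans hb
          obtain ⟨x, hx1⟩ := exists_mem_of_maskE_ne_zero D s hu
          have hx2 : memN D s t.val x = true := by
            have := testBit_maskE D s t.val x; rw [← e, testBit_maskE] at this; exact this ▸ hx1
          rw [label_unique D s hK0 hx1 hx2]; exact Finset.mem_insert_self _ _
        · exact Or.inr ⟨b'', hr, he⟩

/-! ### sorting the blocks and the row list of a partition table -/

/-- `insB` permutes -/
theorem perm_insB (b : ℕ) : ∀ l : List ℕ, (insB b l).Perm (b :: l)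
  | [] => by simp [insB]
  | c :: rest => by
    rw [insB]
    split_ifs
    · exact List.Perm.refl _
    · exact ((perm_insB b rest).cons c).trans (List.Perm.swap b c rest)

/-- `sortB` permutes -/
theorem perm_sortB : ∀ l : List ℕ, (sortB l).Perm l
  | [] => by simp [sortB]
  | b :: rest => by rw [sortB]; exact (perm_insB b _).trans ((perm_sortB rest).cons b)

/-- **the row list of any partition table containing the block list of the orbit `s` contains `rowCode D s`** -/
theorem rowCode_mem_rowsFrom_of {φ : Fin 11 → Fin 11} {P : ℕ} (hP : ∀ t : Fin 11, dig P t.val = (φ t).val)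
    (hK0 : D.PartitionOK s (fun _ => 0) 0) (hK1 : D.PartitionOK s id (D.g1 s)) (hK2 : D.PartitionOK s φ (D.g2 s))
    {bl : List ℕ} (h1 : ∀ b ∈ bl, ∃ t : Fin 11, b &&& 2047 = maskE D s t.val ∧ maskE D s t.val ≠ 0)
    (h2 : (bl.map (· &&& 2047)).Nodup) (h3 : ∀ t : Fin 11, maskE D s t.val ≠ 0 → ∃ b ∈ bl, b &&& 2047 = maskE D s t.val) :
    ∀ L : List (List ℕ), bl ∈ L → rowCode D s ∈ rowsFrom P L
  | [], h => by simp at h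
  | bl' :: rest, h => by
    rw [rowsFrom, List.mem_append]
    rcases List.mem_cons.1 h with rfl | h
    · left
      have hp := perm_sortB bl
      refine rowCode_mem_lab D s hP hK0 hK1 hK2 (sortB bl) ∅ 0 0 0 0 (linv_empty D s φ) (fun b hb => ?_) ?_ (fun t ht => ?_)
      · obtain ⟨t, e, hne⟩ := h1 b (hp.subset hb); exact ⟨t, by simp, e, hne⟩
      · exact (hp.map _).nodup_iff.2 h2
      · obtain ⟨b, hb, e⟩ := h3 t ht; exact Or.inr ⟨b, hp.symm.subset hb, e⟩
    · right; exact rowCode_mem_rowsFrom_of hP hK0 hK1 hK2 h1 h2 h3 rest h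

end Triangle12

end Summit.Ventures.DiscreteObjects.PP12
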